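import Summits.BirchSwinnertonDyer.BirchSwinnertonDyer.Theorems.Rank1ResidualIntModelReduction
import Literature.NumberTheory.EllipticCurves.SerreOpenImageNormalizerCaseProofs
import Literature.NumberTheory.GaloisRepresentations.SerreProp19GL2Fp
import HarnessLib

/-!
# BSD rank-≤1 residual cell: SURJECTIVITY of `ρ̄_{E,p}` from three Serre witnesses (Serre 1972,
# Prop. 19), read off an integer model in the kernel

HONEST FRAMING (cell `b2b-bsdres-*`, verbatim): prove what is provable now; shrink each hard class
to its core with data; no claim beyond stated classes; COMBINATION classes are deleted from
PUBLISHED theorems only, the CONSTRUCTION-shaped remainder is typed; this is not "finishing BSD".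

Theorems only (no definition, no named fact). Companion of `Rank1ResidualIntModelReduction.lean`.
The certificate records of the cell carry, as a HYPOTHESIS certificate for `Surj W p`
(`ρ̄_{E,p} : Γ_ℚ → Aut(E[p])` onto), three "Serre witnesses" `(ℓᵢ, a_{ℓᵢ})` (J.-P. Serre, Invent.
Math. 15 (1972) §2.8 Prop. 19: a subgroup `G ≤ GL₂(𝔽_p)`, `p ≥ 5`, containing `s₁` with
`tr² − 4 det` a non-zero square and `tr ≠ 0`, `s₂` with `tr² − 4 det` a non-square and `tr ≠ 0`,
`s₃` with `u = tr²/det ∉ {0, 1, 2, 4}`, `u² − 3u + 1 ≠ 0`, contains `SL₂(𝔽_p)`; with `det` onto,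
`G = GL₂(𝔽_p)`), with the Frobenius at a good `ℓ ≠ p` having `tr = a_ℓ`, `det = ℓ` modulo `p`.
Every ingredient is a THEOREM of the tree: Prop. 19 itself (`Serre1972.prop19_eq_top`), a frame
`Φ : Aut(E[p]) ≅ GL₂(𝔽_p)` with trace compatibility and `det = χ̄_p` onto `𝔽_pˣ`
(`WeierstrassCurve.exists_frame_galoisRepTorsion_rat`, §5.2 (iii)), `G_p = GL₂(𝔽_p) ↔ Surj`
(`map_range_galoisRepTorsion_eq_top_iff`), the trace of a Frobenius on `E[p]`
(`trace_galoisRepTorsion_frobenius_eq`: `≡ a_ℓ`), and `χ̄_p(Frob_ℓ) = ℓ`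
(`Mazur1978.modPCyclotomicCharacterZMod_of_isArithFrobAt`). Hence:

* `hasSurjectiveModNGaloisRep_of_serreWitnesses` — for a globally minimal elliptic `W/ℚ`, `p ≥ 5`,
  and good primes `ℓ₁, ℓ₂, ℓ₃ ≠ p` whose traces `a_{ℓᵢ} = W.frobeniusTrace ℓᵢ` satisfy Serre's
  three conditions modulo `p`: `W.HasSurjectiveModNGaloisRep p`;
* `hasSurjectiveModNGaloisRep_of_intModel_of_serreWitnesses` — the same with `integralModelInt W = E₀`,
  `ℓᵢ ∤ Δ(E₀)` and the traces supplied by kernel point counts `#(E₀ mod ℓᵢ)(𝔽_{ℓᵢ}) = nᵢ`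
  (`a_{ℓᵢ} = ℓᵢ + 1 − nᵢ`), the three conditions being decidable statements in `ZMod p`.

References: J.-P. Serre, Invent. Math. 15 (1972) §2.8 Prop. 19, §4.2, §5.2 (iii) [Serre1972];
B. Mazur, Invent. Math. 44 (1978) Prop. 6.3 (1) (Frobenius values) [Mazur1978].
-/

set_option linter.dupNamespace false
set_option autoImplicit false

noncomputable section

open scoped Classical MatrixGroups

open IsDedekindDomain NumberField Rat.HeightOneSpectrum WeierstrassCurve Matrix
  Literature.NumberTheory.EllipticCurves Literature.NumberTheory.GaloisRepresentations
  Literature.NumberTheory.GaloisRepresentations.Serre1972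

namespace Summit.BirchSwinnertonDyer.BirchSwinnertonDyer.Rank1Residual.IntModel

/-- **A Frobenius at a good prime `ℓ ≠ p`, framed**: in the image `G_p = Φ(ρ̄_{E,p}(Γ_ℚ))` of a
trace-compatible frame with `det ∘ Φ ∘ ρ̄ = χ̄_p` there is an element of trace `a_ℓ (mod p)` and
determinant `ℓ (mod p)`. [cite: Serre1972, §4.2 (Lemme 3) and §5.2 (iii)] [cite: Mazur1978, §6 Prop. 6.3 (1) (p. 153)] -/
theorem exists_mem_image_trace_eq_det_eq (W : WeierstrassCurve ℚ) [W.IsElliptic]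
    [W.IsGloballyMinimal] (p : ℕ) [Fact p.Prime]
    (Φ : Multiplicative (AddAut (geomTorsion W p)) ≃* GL (Fin 2) (ZMod p))
    (hΦ : letI : Module (ZMod p) (geomTorsion W p) := AddSubgroup.torsionBy.zmodModule
      ∀ g : Multiplicative (AddAut (geomTorsion W p)),
        Matrix.trace ((Φ g : GL (Fin 2) (ZMod p)) : Matrix (Fin 2) (Fin 2) (ZMod p)) =
          LinearMap.trace (ZMod p) (geomTorsion W p)
            ((Multiplicative.toAdd g).toAddMonoidHom.toZModLinearMap p))
    (hdet : ∀ σ : Field.absoluteGaloisGroup ℚ,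
      Matrix.GeneralLinearGroup.det (Φ (galoisRepTorsion W p σ)) = modPCyclotomicCharacterZMod ℚ p σ)
    (ℓ : ℕ) [hℓ : Fact ℓ.Prime] (hℓp : ℓ ≠ p) (hgood : W.HasGoodReductionAtPrime ℓ) :
    ∃ s ∈ (galoisRepTorsion W p).range.map Φ.toMonoidHom,
      (s : Matrix (Fin 2) (Fin 2) (ZMod p)).trace = (W.frobeniusTrace ℓ : ZMod p) ∧
      (s : Matrix (Fin 2) (Fin 2) (ZMod p)).det = (ℓ : ZMod p) := by
  letI : Module (ZMod p) (geomTorsion W p) := AddSubgroup.torsionBy.zmodModule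
  set v : HeightOneSpectrum (𝓞 ℚ) := (primesEquiv (R := 𝓞 ℚ)).symm ⟨ℓ, hℓ.out⟩ with hvdef
  have hvℓ : (primesEquiv v : ℕ) = ℓ := by rw [hvdef, Equiv.apply_symm_apply]
  have hv : (ℓ : 𝓞 ℚ) ∈ v.asIdeal := by
    rw [DeuringLadic.natCast_mem_asIdeal_iff v ℓ, hvℓ]
  obtain ⟨𝔓, h𝔓⟩ := v.primesAbove_nonempty
  obtain ⟨φ, hφ⟩ := HeightOneSpectrum.exists_isArithFrobAt_of_mem_primesAbove_holds (v := v) h𝔓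
  refine ⟨Φ (galoisRepTorsion W p φ), apply_galoisRepTorsion_mem_map_range W p Φ φ, ?_, ?_⟩
  · rw [hΦ, W.trace_galoisRepTorsion_frobenius_eq p hℓp hgood hvℓ h𝔓 hφ]
  · rw [← Matrix.GeneralLinearGroup.val_det_apply, hdet,
      Mazur1978.modPCyclotomicCharacterZMod_of_isArithFrobAt p ℓ hℓp hv h𝔓 hφ]

/-- **Surjectivity of `ρ̄_{E,p}` from three Serre witnesses (Serre 1972, Prop. 19).** Let `W/ℚ`
be a globally minimal elliptic curve, `p ≥ 5`, and `ℓ₁, ℓ₂, ℓ₃ ≠ p` primes of good reduction with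
traces `aᵢ = a_{ℓᵢ}` such that, modulo `p`: `a₁² − 4ℓ₁` is a non-zero square and `a₁ ≠ 0`;
`a₂² − 4ℓ₂` is a non-square and `a₂ ≠ 0`; `a₃² = u ℓ₃` with `u ∉ {0,1,2,4}`, `u² − 3u + 1 ≠ 0`.
Then `ρ̄_{E,p} : Γ_ℚ → Aut(E[p])` is onto: the framed image contains the three Frobenius elements
(`exists_mem_image_trace_eq_det_eq`), has `det` onto `𝔽_pˣ` (§5.2 (iii)), so equals `GL₂(𝔽_p)`
by Prop. 19. [cite: Serre1972, §2.8 Prop. 19 and §5.2 (iii)] -/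
theorem hasSurjectiveModNGaloisRep_of_serreWitnesses (W : WeierstrassCurve ℚ) [W.IsElliptic]
    [W.IsGloballyMinimal] (p : ℕ) [Fact p.Prime] (h5 : 5 ≤ p)
    (ℓ₁ ℓ₂ ℓ₃ : ℕ) [Fact ℓ₁.Prime] [Fact ℓ₂.Prime] [Fact ℓ₃.Prime]
    (h₁ : ℓ₁ ≠ p) (h₂ : ℓ₂ ≠ p) (h₃ : ℓ₃ ≠ p)
    (hg₁ : W.HasGoodReductionAtPrime ℓ₁) (hg₂ : W.HasGoodReductionAtPrime ℓ₂)
    (hg₃ : W.HasGoodReductionAtPrime ℓ₃)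
    (hi : IsSquare ((W.frobeniusTrace ℓ₁ : ZMod p) ^ 2 - 4 * ℓ₁) ∧
      (W.frobeniusTrace ℓ₁ : ZMod p) ^ 2 - 4 * ℓ₁ ≠ 0 ∧ (W.frobeniusTrace ℓ₁ : ZMod p) ≠ 0)
    (hii : ¬ IsSquare ((W.frobeniusTrace ℓ₂ : ZMod p) ^ 2 - 4 * ℓ₂) ∧
      (W.frobeniusTrace ℓ₂ : ZMod p) ≠ 0)
    (hiii : ∃ u : ZMod p, (W.frobeniusTrace ℓ₃ : ZMod p) ^ 2 = u * ℓ₃ ∧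
      u ≠ 0 ∧ u ≠ 1 ∧ u ≠ 2 ∧ u ≠ 4 ∧ u ^ 2 - 3 * u + 1 ≠ 0) :
    W.HasSurjectiveModNGaloisRep p := by
  obtain ⟨e, Φ, -, hΦ, hdet, hdetsurj, -⟩ := W.exists_frame_galoisRepTorsion_rat p
  rw [← map_range_galoisRepTorsion_eq_top_iff W p Φ]
  set G := (galoisRepTorsion W p).range.map Φ.toMonoidHom with hG
  obtain ⟨s₁, hs₁, ht₁, hd₁⟩ := exists_mem_image_trace_eq_det_eq W p Φ hΦ hdet ℓ₁ h₁ hg₁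
  obtain ⟨s₂, hs₂, ht₂, hd₂⟩ := exists_mem_image_trace_eq_det_eq W p Φ hΦ hdet ℓ₂ h₂ hg₂
  obtain ⟨s₃, hs₃, ht₃, hd₃⟩ := exists_mem_image_trace_eq_det_eq W p Φ hΦ hdet ℓ₃ h₃ hg₃
  refine prop19_eq_top G h5 ⟨s₁, hs₁, ?_, ?_⟩ ⟨s₂, hs₂, ?_, ?_⟩ ⟨s₃, hs₃, ?_⟩ fun u ↦ ?_
  · rw [ht₁, hd₁]; exact ⟨hi.1, hi.2.1⟩
  · rw [ht₁]; exact hi.2.2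
  · rw [ht₂, hd₂]; exact hii.1
  · rw [ht₂]; exact hii.2
  · rw [ht₃, hd₃]; exact hiii
  · obtain ⟨σ, hσ⟩ := hdetsurj u
    exact ⟨Φ (galoisRepTorsion W p σ), apply_galoisRepTorsion_mem_map_range W p Φ σ, hσ⟩

/-- **Surjectivity of `ρ̄_{E,p}` from three Serre witnesses READ OFF AN INTEGER MODEL**: as
`hasSurjectiveModNGaloisRep_of_serreWitnesses` with `integralModelInt W = E₀`, good reduction from
`ℓᵢ ∤ Δ(E₀)`, and the traces from kernel point counts `#(E₀ mod ℓᵢ)(𝔽_{ℓᵢ}) = nᵢ`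
(`a_{ℓᵢ} = ℓᵢ + 1 − nᵢ`); the three Serre conditions are then decidable statements in `ZMod p`.
[cite: Serre1972, §2.8 Prop. 19 and §5.2 (iii)] -/
theorem hasSurjectiveModNGaloisRep_of_intModel_of_serreWitnesses {W : WeierstrassCurve ℚ}
    [W.IsElliptic] [W.IsGloballyMinimal] {E₀ : WeierstrassCurve ℤ} (hI : integralModelInt W = E₀)
    (p : ℕ) [Fact p.Prime] (h5 : 5 ≤ p)
    (ℓ₁ ℓ₂ ℓ₃ : ℕ) [Fact ℓ₁.Prime] [Fact ℓ₂.Prime] [Fact ℓ₃.Prime]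
    (h₁ : ℓ₁ ≠ p) (h₂ : ℓ₂ ≠ p) (h₃ : ℓ₃ ≠ p)
    (hΔ₁ : ¬ (ℓ₁ : ℤ) ∣ E₀.Δ) (hΔ₂ : ¬ (ℓ₂ : ℤ) ∣ E₀.Δ) (hΔ₃ : ¬ (ℓ₃ : ℤ) ∣ E₀.Δ)
    {n₁ n₂ n₃ : ℕ}
    (hc₁ : Nat.card ((E₀.map (Int.castRingHom (ZMod ℓ₁))).toAffine.Point) = n₁)
    (hc₂ : Nat.card ((E₀.map (Int.castRingHom (ZMod ℓ₂))).toAffine.Point) = n₂)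
    (hc₃ : Nat.card ((E₀.map (Int.castRingHom (ZMod ℓ₃))).toAffine.Point) = n₃)
    (hi : IsSquare ((((ℓ₁ : ℤ) + 1 - n₁ : ℤ) : ZMod p) ^ 2 - 4 * ℓ₁) ∧
      (((ℓ₁ : ℤ) + 1 - n₁ : ℤ) : ZMod p) ^ 2 - 4 * ℓ₁ ≠ 0 ∧ (((ℓ₁ : ℤ) + 1 - n₁ : ℤ) : ZMod p) ≠ 0)
    (hii : ¬ IsSquare ((((ℓ₂ : ℤ) + 1 - n₂ : ℤ) : ZMod p) ^ 2 - 4 * ℓ₂) ∧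
      (((ℓ₂ : ℤ) + 1 - n₂ : ℤ) : ZMod p) ≠ 0)
    (hiii : ∃ u : ZMod p, (((ℓ₃ : ℤ) + 1 - n₃ : ℤ) : ZMod p) ^ 2 = u * ℓ₃ ∧
      u ≠ 0 ∧ u ≠ 1 ∧ u ≠ 2 ∧ u ≠ 4 ∧ u ^ 2 - 3 * u + 1 ≠ 0) :
    W.HasSurjectiveModNGaloisRep p := by
  have hg : ∀ (ℓ : ℕ) [Fact ℓ.Prime], ¬ (ℓ : ℤ) ∣ E₀.Δ → W.HasGoodReductionAtPrime ℓ :=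
    fun ℓ _ h ↦ hasGoodReductionAtPrime_of_not_dvd W ℓ (by rw [minimalDiscriminantInt_eq hI]; exact h)
  refine hasSurjectiveModNGaloisRep_of_serreWitnesses W p h5 ℓ₁ ℓ₂ ℓ₃ h₁ h₂ h₃ (hg ℓ₁ hΔ₁)
    (hg ℓ₂ hΔ₂) (hg ℓ₃ hΔ₃) ?_ ?_ ?_
  · rw [frobeniusTrace_eq hI hc₁]; exact hi
  · rw [frobeniusTrace_eq hI hc₂]; exact hii
  · rw [frobeniusTrace_eq hI hc₃]; exact hiii

end Summit.BirchSwinnertonDyer.BirchSwinnertonDyer.Rank1Residual.IntModel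

end
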